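import Literature.Probability.LatticeModels.StrongHarrisKleitman
import Literature.Probability.Percolation.StrongHarrisThreePoint
import Summits.CriticalPhenomena.PercolationContinuityZ3.Theorems.PercNearOneGluingNoHeavyLowerTailSunflowerCubicStep
import Summits.CriticalPhenomena.PercolationContinuityZ3.Theorems.PercNearOneGluingNoHeavyLowerTailSunflowerCubicInduction
import Mathlib.Tactic.LinearCombination
import HarnessLib

/-!
# `NoHeavyLowerTail` (stmt-CriticalPhenomena-4575) — lattice AG⁺ from a BERNSTEIN-GOOD coordinate (the induction
# shell that survives the hexagon obstruction)

Support file (`--supports stmt-CriticalPhenomena-4575`, seat `prim-ineq-prove-4` gen 2).  Variant of `SunflowerCubic.core`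
(`…SunflowerCubicInduction.lean`): same setting, same strong induction and measure bookkeeping; ONLY the step changes.  The hypothesis of `core` (EXISTS-GOOD-COORDINATE,
`L_e ≥ 0`, i.e. `Φ(law)` above its chord) is FALSE — the hexagon `C₆` with terminals at alternating vertices at
`p = 1/3` has `L_e = −10688/3¹⁶ < 0` at every edge (evidence `EGC-REFUTED.md` on the item).  Writing the cubic
`Φ(law p)` in Bernstein form `(1−p)³Φ₀ + 3p(1−p)²B₁ + 3p²(1−p)B₂ + p³Φ₁` (prim-cert-1,
`SunflowerCubicBernstein.bernstein_identity`), `3B₁ = 2Φ₀ + Φ₁ + K₀` and `3B₂ = Φ₀ + 2Φ₁ + K₁` where `K₀, K₁` are the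
endpoint values of the chord bracket `L_e = (1−p)K₀ + pK₁` of `SunflowerCubicStep.step_identity`; a coordinate is
BERNSTEIN-GOOD if `3B₁ ≥ 0 ∧ 3B₂ ≥ 0`, and then `Φ₀, Φ₁ ≥ 0` (induction) give `Φ(law p) ≥ 0`.
* `SunflowerCubic.core_bernstein` — **if every three-petal sunflower system of cylinder events over a nonempty
  coordinate set has a Bernstein-good coordinate in that set, then lattice AG⁺ holds for every such system.**
  The hypothesis is written out in the section masses (`X⁰ = (· \\ {e}) ⁻¹' X`, `X¹ = insert e ⁻¹' X`): with
  `Φ₀ = μ(A⁰)μ(B⁰) − e₂(μ(C⁰)) − e₃(μ(C⁰))`, `Φ₁` likewise, `d, cp i, cm i` as in `core`, `α = d + Σ cp`, `β = d + Σ cm`,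
  `δ i = cm i − cp i`, `K₀ = αβ + Σ_{i<j}(1 + μ(C⁰ m))δ_iδ_j + δ₀δ₁δ₂`, `K₁ = αβ + Σ_{i<j}(1 + μ(C¹ m))δ_iδ_j − δ₀δ₁δ₂`:
  `∃ e ∈ F, 0 ≤ 2Φ₀ + Φ₁ + K₀ ∧ 0 ≤ Φ₀ + 2Φ₁ + K₁`.
Status (2026-08-19): every coordinate of every censused system is Bernstein-good (fibre census ≤ 5 coordinates, memo
`FROM-prim-cert-1-gen3-BERNSTEIN-GOOD.md`; this seat's census, memo `MEMO-AGPLUS-LATTICE.md` §13).  No unproved fact is used.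
-/

noncomputable section

namespace Summit.CriticalPhenomena.PercolationContinuityZ3.Theorems

open MeasureTheory Literature.Probability.LatticeModels Literature.Probability.LatticeModels.StrongHarris
open Literature.Probability.Percolation

namespace SunflowerCubic

variable {ι : Type*}

/-- **Lattice AG⁺ from Bernstein-good coordinates (cylinder-event form, induction on the coordinate set).**  With
`μ = prodBernoulli p`: if every three-petal sunflower system of cylinder events over a nonempty finite coordinate set `F`
has a BERNSTEIN-GOOD coordinate `e ∈ F` (`2Φ₀ + Φ₁ + K₀ ≥ 0` and `Φ₀ + 2Φ₁ + K₁ ≥ 0`, module docstring), then every such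
system satisfies `e₂(μ(C)) + e₃(μ(C)) ≤ μ(A) μ(B)`.
[cite: Gladkov2024StrongFKG, Thm. 2.1 (the induction shell); this file] -/
theorem core_bernstein [DecidableEq ι] (p : ι → unitInterval)
    (hgood : ∀ (F : Finset ι) (A B : Set (Set ι)) (C : Fin 3 → Set (Set ι)), F.Nonempty →
      (∀ i ∈ (Finset.univ : Finset (Fin 3)), ∀ j ∈ (Finset.univ : Finset (Fin 3)), i ≠ j →
        Disjoint (C i) (C j)) →
      (∀ i ∈ (Finset.univ : Finset (Fin 3)), Disjoint A (C i)) →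
      (∀ i ∈ (Finset.univ : Finset (Fin 3)), IsUpperSet (A ∪ C i)) → IsUpperSet A →
      (∀ ω, ω ∈ B ↔ ω ∉ A ∧ ∀ i ∈ (Finset.univ : Finset (Fin 3)), ω ∉ C i) →
      DeterminedBy A (↑F : Set ι) → (∀ i ∈ (Finset.univ : Finset (Fin 3)), DeterminedBy (C i) (↑F : Set ι)) →
      ∃ e ∈ F,
        0 ≤ 2 * ((prodBernoulli p).real ((· \ {e}) ⁻¹' A) * (prodBernoulli p).real ((· \ {e}) ⁻¹' B) -
              ((prodBernoulli p).real ((· \ {e}) ⁻¹' C 0) * (prodBernoulli p).real ((· \ {e}) ⁻¹' C 1) + (prodBernoulli p).real ((· \ {e}) ⁻¹' C 0) * (prodBernoulli p).real ((· \ {e}) ⁻¹' C 2) +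
                (prodBernoulli p).real ((· \ {e}) ⁻¹' C 1) * (prodBernoulli p).real ((· \ {e}) ⁻¹' C 2)) -
              (prodBernoulli p).real ((· \ {e}) ⁻¹' C 0) * (prodBernoulli p).real ((· \ {e}) ⁻¹' C 1) * (prodBernoulli p).real ((· \ {e}) ⁻¹' C 2)) +
          ((prodBernoulli p).real (insert e ⁻¹' A) * (prodBernoulli p).real (insert e ⁻¹' B) -
              ((prodBernoulli p).real (insert e ⁻¹' C 0) * (prodBernoulli p).real (insert e ⁻¹' C 1) + (prodBernoulli p).real (insert e ⁻¹' C 0) * (prodBernoulli p).real (insert e ⁻¹' C 2) +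
                (prodBernoulli p).real (insert e ⁻¹' C 1) * (prodBernoulli p).real (insert e ⁻¹' C 2)) -
              (prodBernoulli p).real (insert e ⁻¹' C 0) * (prodBernoulli p).real (insert e ⁻¹' C 1) * (prodBernoulli p).real (insert e ⁻¹' C 2)) +
          (((prodBernoulli p).real (((· \ {e}) ⁻¹' B) ∩ (insert e ⁻¹' A)) +
                ((prodBernoulli p).real (((· \ {e}) ⁻¹' C 0) ∩ (insert e ⁻¹' A)) +
                  (prodBernoulli p).real (((· \ {e}) ⁻¹' C 1) ∩ (insert e ⁻¹' A)) +
                  (prodBernoulli p).real (((· \ {e}) ⁻¹' C 2) ∩ (insert e ⁻¹' A)))) *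
              ((prodBernoulli p).real (((· \ {e}) ⁻¹' B) ∩ (insert e ⁻¹' A)) +
                ((prodBernoulli p).real (((· \ {e}) ⁻¹' B) ∩ (insert e ⁻¹' C 0)) +
                  (prodBernoulli p).real (((· \ {e}) ⁻¹' B) ∩ (insert e ⁻¹' C 1)) +
                  (prodBernoulli p).real (((· \ {e}) ⁻¹' B) ∩ (insert e ⁻¹' C 2)))) +
            ((1 + (prodBernoulli p).real ((· \ {e}) ⁻¹' C 2)) * (((prodBernoulli p).real (((· \ {e}) ⁻¹' B) ∩ (insert e ⁻¹' C 0)) -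
                    (prodBernoulli p).real (((· \ {e}) ⁻¹' C 0) ∩ (insert e ⁻¹' A))) * ((prodBernoulli p).real (((· \ {e}) ⁻¹' B) ∩ (insert e ⁻¹' C 1)) -
                    (prodBernoulli p).real (((· \ {e}) ⁻¹' C 1) ∩ (insert e ⁻¹' A)))) +
              (1 + (prodBernoulli p).real ((· \ {e}) ⁻¹' C 1)) * (((prodBernoulli p).real (((· \ {e}) ⁻¹' B) ∩ (insert e ⁻¹' C 0)) -
                    (prodBernoulli p).real (((· \ {e}) ⁻¹' C 0) ∩ (insert e ⁻¹' A))) * ((prodBernoulli p).real (((· \ {e}) ⁻¹' B) ∩ (insert e ⁻¹' C 2)) -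
                    (prodBernoulli p).real (((· \ {e}) ⁻¹' C 2) ∩ (insert e ⁻¹' A)))) +
              (1 + (prodBernoulli p).real ((· \ {e}) ⁻¹' C 0)) * (((prodBernoulli p).real (((· \ {e}) ⁻¹' B) ∩ (insert e ⁻¹' C 1)) -
                    (prodBernoulli p).real (((· \ {e}) ⁻¹' C 1) ∩ (insert e ⁻¹' A))) * ((prodBernoulli p).real (((· \ {e}) ⁻¹' B) ∩ (insert e ⁻¹' C 2)) -
                    (prodBernoulli p).real (((· \ {e}) ⁻¹' C 2) ∩ (insert e ⁻¹' A))))) +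
            ((prodBernoulli p).real (((· \ {e}) ⁻¹' B) ∩ (insert e ⁻¹' C 0)) -
                    (prodBernoulli p).real (((· \ {e}) ⁻¹' C 0) ∩ (insert e ⁻¹' A))) * ((prodBernoulli p).real (((· \ {e}) ⁻¹' B) ∩ (insert e ⁻¹' C 1)) -
                    (prodBernoulli p).real (((· \ {e}) ⁻¹' C 1) ∩ (insert e ⁻¹' A))) * ((prodBernoulli p).real (((· \ {e}) ⁻¹' B) ∩ (insert e ⁻¹' C 2)) -
                    (prodBernoulli p).real (((· \ {e}) ⁻¹' C 2) ∩ (insert e ⁻¹' A)))) ∧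
        0 ≤ ((prodBernoulli p).real ((· \ {e}) ⁻¹' A) * (prodBernoulli p).real ((· \ {e}) ⁻¹' B) -
              ((prodBernoulli p).real ((· \ {e}) ⁻¹' C 0) * (prodBernoulli p).real ((· \ {e}) ⁻¹' C 1) + (prodBernoulli p).real ((· \ {e}) ⁻¹' C 0) * (prodBernoulli p).real ((· \ {e}) ⁻¹' C 2) +
                (prodBernoulli p).real ((· \ {e}) ⁻¹' C 1) * (prodBernoulli p).real ((· \ {e}) ⁻¹' C 2)) -
              (prodBernoulli p).real ((· \ {e}) ⁻¹' C 0) * (prodBernoulli p).real ((· \ {e}) ⁻¹' C 1) * (prodBernoulli p).real ((· \ {e}) ⁻¹' C 2)) +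
          2 * ((prodBernoulli p).real (insert e ⁻¹' A) * (prodBernoulli p).real (insert e ⁻¹' B) -
              ((prodBernoulli p).real (insert e ⁻¹' C 0) * (prodBernoulli p).real (insert e ⁻¹' C 1) + (prodBernoulli p).real (insert e ⁻¹' C 0) * (prodBernoulli p).real (insert e ⁻¹' C 2) +
                (prodBernoulli p).real (insert e ⁻¹' C 1) * (prodBernoulli p).real (insert e ⁻¹' C 2)) -
              (prodBernoulli p).real (insert e ⁻¹' C 0) * (prodBernoulli p).real (insert e ⁻¹' C 1) * (prodBernoulli p).real (insert e ⁻¹' C 2)) +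
          (((prodBernoulli p).real (((· \ {e}) ⁻¹' B) ∩ (insert e ⁻¹' A)) +
                ((prodBernoulli p).real (((· \ {e}) ⁻¹' C 0) ∩ (insert e ⁻¹' A)) +
                  (prodBernoulli p).real (((· \ {e}) ⁻¹' C 1) ∩ (insert e ⁻¹' A)) +
                  (prodBernoulli p).real (((· \ {e}) ⁻¹' C 2) ∩ (insert e ⁻¹' A)))) *
              ((prodBernoulli p).real (((· \ {e}) ⁻¹' B) ∩ (insert e ⁻¹' A)) +
                ((prodBernoulli p).real (((· \ {e}) ⁻¹' B) ∩ (insert e ⁻¹' C 0)) +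
                  (prodBernoulli p).real (((· \ {e}) ⁻¹' B) ∩ (insert e ⁻¹' C 1)) +
                  (prodBernoulli p).real (((· \ {e}) ⁻¹' B) ∩ (insert e ⁻¹' C 2)))) +
            ((1 + (prodBernoulli p).real (insert e ⁻¹' C 2)) * (((prodBernoulli p).real (((· \ {e}) ⁻¹' B) ∩ (insert e ⁻¹' C 0)) -
                    (prodBernoulli p).real (((· \ {e}) ⁻¹' C 0) ∩ (insert e ⁻¹' A))) * ((prodBernoulli p).real (((· \ {e}) ⁻¹' B) ∩ (insert e ⁻¹' C 1)) -
                    (prodBernoulli p).real (((· \ {e}) ⁻¹' C 1) ∩ (insert e ⁻¹' A)))) +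
              (1 + (prodBernoulli p).real (insert e ⁻¹' C 1)) * (((prodBernoulli p).real (((· \ {e}) ⁻¹' B) ∩ (insert e ⁻¹' C 0)) -
                    (prodBernoulli p).real (((· \ {e}) ⁻¹' C 0) ∩ (insert e ⁻¹' A))) * ((prodBernoulli p).real (((· \ {e}) ⁻¹' B) ∩ (insert e ⁻¹' C 2)) -
                    (prodBernoulli p).real (((· \ {e}) ⁻¹' C 2) ∩ (insert e ⁻¹' A)))) +
              (1 + (prodBernoulli p).real (insert e ⁻¹' C 0)) * (((prodBernoulli p).real (((· \ {e}) ⁻¹' B) ∩ (insert e ⁻¹' C 1)) -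
                    (prodBernoulli p).real (((· \ {e}) ⁻¹' C 1) ∩ (insert e ⁻¹' A))) * ((prodBernoulli p).real (((· \ {e}) ⁻¹' B) ∩ (insert e ⁻¹' C 2)) -
                    (prodBernoulli p).real (((· \ {e}) ⁻¹' C 2) ∩ (insert e ⁻¹' A))))) -
            ((prodBernoulli p).real (((· \ {e}) ⁻¹' B) ∩ (insert e ⁻¹' C 0)) -
                    (prodBernoulli p).real (((· \ {e}) ⁻¹' C 0) ∩ (insert e ⁻¹' A))) * ((prodBernoulli p).real (((· \ {e}) ⁻¹' B) ∩ (insert e ⁻¹' C 1)) -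
                    (prodBernoulli p).real (((· \ {e}) ⁻¹' C 1) ∩ (insert e ⁻¹' A))) * ((prodBernoulli p).real (((· \ {e}) ⁻¹' B) ∩ (insert e ⁻¹' C 2)) -
                    (prodBernoulli p).real (((· \ {e}) ⁻¹' C 2) ∩ (insert e ⁻¹' A))))
      )
    (n : ℕ) :
    ∀ (F : Finset ι), F.card = n → ∀ (A B : Set (Set ι)) (C : Fin 3 → Set (Set ι)),
      (∀ i ∈ (Finset.univ : Finset (Fin 3)), ∀ j ∈ (Finset.univ : Finset (Fin 3)), i ≠ j →
        Disjoint (C i) (C j)) →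
      (∀ i ∈ (Finset.univ : Finset (Fin 3)), Disjoint A (C i)) →
      (∀ i ∈ (Finset.univ : Finset (Fin 3)), IsUpperSet (A ∪ C i)) → IsUpperSet A →
      (∀ ω, ω ∈ B ↔ ω ∉ A ∧ ∀ i ∈ (Finset.univ : Finset (Fin 3)), ω ∉ C i) →
      DeterminedBy A (↑F : Set ι) → (∀ i ∈ (Finset.univ : Finset (Fin 3)), DeterminedBy (C i) (↑F : Set ι)) →
      (prodBernoulli p).real (C 0) * (prodBernoulli p).real (C 1) +
            (prodBernoulli p).real (C 0) * (prodBernoulli p).real (C 2) +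
            (prodBernoulli p).real (C 1) * (prodBernoulli p).real (C 2) +
          (prodBernoulli p).real (C 0) * (prodBernoulli p).real (C 1) * (prodBernoulli p).real (C 2) ≤
        (prodBernoulli p).real A * (prodBernoulli p).real B := by
  set μ := prodBernoulli p with hμ
  induction n using Nat.strong_induction_on with
  | _ n ih =>
    intro F hFn A B C hdisj hdisjA hup hupA hB hA hC
    rcases F.eq_empty_or_nonempty with hF0 | hFne
    · -- `F = ∅`: every event is `∅` or `univ`; the petals are disjoint, so all products vanish
      subst hF0
      have triv : ∀ X : Set (Set ι), DeterminedBy X (↑(∅ : Finset ι) : Set ι) →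
          X = ∅ ∨ X = Set.univ := by
        intro X hX
        rw [determinedBy_iff] at hX
        by_cases hne : X.Nonempty
        · obtain ⟨ω₀, hω₀⟩ := hne
          exact Or.inr (Set.eq_univ_of_forall fun ω => (hX ω ω₀ (by simp)).2 hω₀)
        · exact Or.inl (Set.not_nonempty_iff_eq_empty.1 hne)
      have hc01 : ∀ i ∈ (Finset.univ : Finset (Fin 3)), μ.real (C i) = 0 ∨ μ.real (C i) = 1 := by
        intro i hi
        rcases triv (C i) (hC i hi) with h | h
        · exact Or.inl (by rw [h, measureReal_empty])
        · exact Or.inr (by rw [h, probReal_univ])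
      have hle1 : ∑ i ∈ (Finset.univ : Finset (Fin 3)), μ.real (C i) ≤ 1 := by
        rw [← measureReal_biUnion_finset (μ := μ)
          (fun i hi j hj hij => hdisj i (Finset.mem_coe.1 hi) j (Finset.mem_coe.1 hj) hij)
          (fun i hi => (hC i hi).measurableSet_of_finset) (fun i _ => measure_ne_top _ _)]
        exact (measureReal_mono (Set.subset_univ _) (measure_ne_top _ _)).trans_eq probReal_univ
      rw [Fin.sum_univ_three] at hle1
      have hAB : 0 ≤ μ.real A * μ.real B := by positivity
      have hz := e23_eq_zero_of_01 (hc01 0 (Finset.mem_univ _)) (hc01 1 (Finset.mem_univ _))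
        (hc01 2 (Finset.mem_univ _)) hle1
      linarith
    · -- `F ≠ ∅`: remove a GOOD coordinate `e ∈ F`
      obtain ⟨e, heF, hB1e, hB2e⟩ := hgood F A B C hFne hdisj hdisjA hup hupA hB hA hC
      set F' := F.erase e with hF'd
      have hFins : insert e F' = F := Finset.insert_erase heF
      have hcard : F'.card < n := by
        rw [hF'd, Finset.card_erase_of_mem heF, hFn]
        exact Nat.sub_lt (by rw [← hFn]; exact Finset.card_pos.2 hFne) Nat.one_pos
      -- notation for the sections
      set A₁ := insert e ⁻¹' A with hA₁d
      set A₀ := (· \ {e}) ⁻¹' A with hA₀d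
      set B₁ := insert e ⁻¹' B with hB₁d
      set B₀ := (· \ {e}) ⁻¹' B with hB₀d
      set C₁ : Fin 3 → Set (Set ι) := fun i => insert e ⁻¹' C i with hC₁d
      set C₀ : Fin 3 → Set (Set ι) := fun i => (· \ {e}) ⁻¹' C i with hC₀d
      have hle : ∀ ω : Set ι, ω \ {e} ≤ insert e ω := fun ω =>
        (Set.sdiff_subset).trans (Set.subset_insert e ω)
      -- the sections are again systems of cylinder events, now over `F'`
      have hA' : DeterminedBy A (↑(insert e F') : Set ι) := by rw [hFins]; exact hA
      have hC' : ∀ i ∈ (Finset.univ : Finset (Fin 3)), DeterminedBy (C i) (↑(insert e F') : Set ι) := by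
        intro i hi; rw [hFins]; exact hC i hi
      have hBdet : DeterminedBy B (↑(insert e F') : Set ι) := determinedBy_bottom hB hA' hC'
      have hBdetF : DeterminedBy B (↑F : Set ι) := by rw [← hFins]; exact hBdet
      have hA₁ : DeterminedBy A₁ (↑F' : Set ι) := determinedBy_preimage_insert hA'
      have hA₀ : DeterminedBy A₀ (↑F' : Set ι) := determinedBy_preimage_sdiff hA'
      have hB₁ : DeterminedBy B₁ (↑F' : Set ι) := determinedBy_preimage_insert hBdet
      have hB₀ : DeterminedBy B₀ (↑F' : Set ι) := determinedBy_preimage_sdiff hBdet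
      have hC₁ : ∀ i ∈ (Finset.univ : Finset (Fin 3)), DeterminedBy (C₁ i) (↑F' : Set ι) := fun i hi =>
        determinedBy_preimage_insert (hC' i hi)
      have hC₀ : ∀ i ∈ (Finset.univ : Finset (Fin 3)), DeterminedBy (C₀ i) (↑F' : Set ι) := fun i hi =>
        determinedBy_preimage_sdiff (hC' i hi)
      -- induction hypotheses for the two sections
      have ih₁ := ih F'.card hcard F' rfl A₁ B₁ C₁ (fun i hi j hj hij => (hdisj i hi j hj hij).preimage _)
        (fun i hi => (hdisjA i hi).preimage _)
        (fun i hi => isUpperSet_preimage_insert (hup i hi)) (isUpperSet_preimage_insert hupA)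
        (fun ω => by simpa [hB₁d, hA₁d, hC₁d] using hB (insert e ω)) hA₁ hC₁
      have ih₀ := ih F'.card hcard F' rfl A₀ B₀ C₀ (fun i hi j hj hij => (hdisj i hi j hj hij).preimage _)
        (fun i hi => (hdisjA i hi).preimage _)
        (fun i hi => isUpperSet_preimage_sdiff (hup i hi)) (isUpperSet_preimage_sdiff hupA)
        (fun ω => by simpa [hB₀d, hA₀d, hC₀d] using hB (ω \ {e})) hA₀ hC₀
      -- measurability of everything in sight (cylinder events over `F'`)
      have mA₁ : MeasurableSet A₁ := hA₁.measurableSet_of_finset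
      have mA₀ : MeasurableSet A₀ := hA₀.measurableSet_of_finset
      have mB₀ : MeasurableSet B₀ := hB₀.measurableSet_of_finset
      have mB₁ : MeasurableSet B₁ := hB₁.measurableSet_of_finset
      have mC₁ : ∀ i ∈ (Finset.univ : Finset (Fin 3)), MeasurableSet (C₁ i) := fun i hi =>
        (hC₁ i hi).measurableSet_of_finset
      have mC₀ : ∀ i ∈ (Finset.univ : Finset (Fin 3)), MeasurableSet (C₀ i) := fun i hi =>
        (hC₀ i hi).measurableSet_of_finset
      -- the twelve refined masses
      set a₀ : ℝ := μ.real A₀ with ha₀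
      set b₁ : ℝ := μ.real B₁ with hb₁
      set d : ℝ := μ.real (B₀ ∩ A₁) with hd
      set cp : Fin 3 → ℝ := fun i => μ.real (C₀ i ∩ A₁) with hcp
      set co : Fin 3 → ℝ := fun i => μ.real (C₀ i ∩ C₁ i) with hco
      set cm : Fin 3 → ℝ := fun i => μ.real (B₀ ∩ C₁ i) with hcm
      have hBC : ∀ i ∈ (Finset.univ : Finset (Fin 3)), Disjoint B (C i) := fun i hi =>
        Set.disjoint_left.2 fun ω hω hCω => ((hB ω).1 hω).2 i hi hCω
      have hBA : Disjoint B A := Set.disjoint_left.2 fun ω hω hAω => ((hB ω).1 hω).1 hAω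
      -- every configuration lies in `A`, in `B`, or in some petal
      have htri : ∀ ω : Set ι, ω ∈ A ∨ ω ∈ B ∨ ∃ i, ω ∈ C i := by
        intro ω
        by_cases h1 : ω ∈ A
        · exact Or.inl h1
        by_cases h2 : ∃ i, ω ∈ C i
        · exact Or.inr (Or.inr h2)
        · exact Or.inr (Or.inl ((hB ω).2 ⟨h1, fun i _ hi => h2 ⟨i, hi⟩⟩))
      -- `μ(C_i¹) = co_i + cm_i`
      have hc₁ : ∀ i ∈ (Finset.univ : Finset (Fin 3)), μ.real (C₁ i) = co i + cm i := by
        intro i hi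
        have hset : C₁ i = (C₀ i ∩ C₁ i) ∪ (B₀ ∩ C₁ i) := by
          ext ω
          simp only [Set.mem_union, Set.mem_inter_iff, hC₁d, hC₀d, hB₀d, Set.mem_preimage]
          constructor
          · intro hω
            rcases bottom_or_same_of_le hdisj hdisjA hup hupA hB hi (hle ω) hω with hB' | hC'
            · exact Or.inr ⟨hB', hω⟩
            · exact Or.inl ⟨hC', hω⟩
          · rintro (⟨-, h1⟩ | ⟨-, h1⟩) <;> exact h1
        have hdj : Disjoint (C₀ i ∩ C₁ i) (B₀ ∩ C₁ i) :=
          Set.disjoint_left.2 fun ω h1 h2 => Set.disjoint_left.1 (hBC i hi) h2.1 h1.1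
        rw [hco, hcm]
        simp only
        rw [← measureReal_union hdj (mB₀.inter (mC₁ i hi)) (measure_ne_top _ _) (measure_ne_top _ _),
          ← hset]
      -- `μ(C_i⁰) = co_i + cp_i`
      have hc₀ : ∀ i ∈ (Finset.univ : Finset (Fin 3)), μ.real (C₀ i) = co i + cp i := by
        intro i hi
        have hset : C₀ i = (C₀ i ∩ C₁ i) ∪ (C₀ i ∩ A₁) := by
          ext ω
          simp only [Set.mem_union, Set.mem_inter_iff, hC₁d, hC₀d, hA₁d, Set.mem_preimage]
          constructor
          · intro hω
            rcases hup i hi (hle ω) (Or.inr hω) with hA'' | hC''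
            · exact Or.inr ⟨hω, hA''⟩
            · exact Or.inl ⟨hω, hC''⟩
          · rintro (⟨h1, -⟩ | ⟨h1, -⟩) <;> exact h1
        have hdj : Disjoint (C₀ i ∩ C₁ i) (C₀ i ∩ A₁) :=
          Set.disjoint_left.2 fun ω h1 h2 => Set.disjoint_left.1 (hdisjA i hi) h2.2 h1.2
        rw [hco, hcp]
        simp only
        rw [← measureReal_union hdj ((mC₀ i hi).inter mA₁) (measure_ne_top _ _) (measure_ne_top _ _),
          ← hset]
      -- `μ(A¹) = a₀ + d + Σ cp`
      have ha₁ : μ.real A₁ = a₀ + d + (cp 0 + cp 1 + cp 2) := by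
        have hset : A₁ = (A₀ ∪ (B₀ ∩ A₁)) ∪ ⋃ i ∈ (Finset.univ : Finset (Fin 3)), (C₀ i ∩ A₁) := by
          ext ω
          simp only [Set.mem_union, Set.mem_inter_iff, Set.mem_iUnion, exists_prop, Finset.mem_univ,
            true_and, hA₁d, hA₀d, hB₀d, hC₀d, Set.mem_preimage]
          constructor
          · intro hω
            rcases htri (ω \ {e}) with h | h | ⟨i, h⟩
            · exact Or.inl (Or.inl h)
            · exact Or.inl (Or.inr ⟨h, hω⟩)
            · exact Or.inr ⟨i, h, hω⟩
          · rintro ((h | ⟨-, h⟩) | ⟨i, -, h⟩)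
            · exact hupA (hle ω) h
            · exact h
            · exact h
        have hpd : (↑(Finset.univ : Finset (Fin 3)) : Set (Fin 3)).PairwiseDisjoint fun i => C₀ i ∩ A₁ :=
          fun i hi j hj hij => Set.disjoint_left.2 fun ω h1 h2 =>
            Set.disjoint_left.1 (hdisj i (Finset.mem_coe.1 hi) j (Finset.mem_coe.1 hj) hij) h1.1 h2.1
        have hd1 : Disjoint A₀ (B₀ ∩ A₁) :=
          Set.disjoint_left.2 fun ω h1 h2 => Set.disjoint_left.1 hBA h2.1 h1
        have hd2 : Disjoint (A₀ ∪ (B₀ ∩ A₁)) (⋃ i ∈ (Finset.univ : Finset (Fin 3)), (C₀ i ∩ A₁)) := by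
          refine Set.disjoint_left.2 fun ω h1 h2 => ?_
          simp only [Set.mem_iUnion, Set.mem_inter_iff, exists_prop] at h2
          obtain ⟨i, hi, h3, -⟩ := h2
          rcases h1 with h1 | ⟨h1, -⟩
          · exact Set.disjoint_left.1 (hdisjA i hi) h1 h3
          · exact Set.disjoint_left.1 (hBC i hi) h1 h3
        have hmU : MeasurableSet (⋃ i ∈ (Finset.univ : Finset (Fin 3)), (C₀ i ∩ A₁)) :=
          Finset.measurableSet_biUnion _ fun i hi => (mC₀ i hi).inter mA₁
        rw [hset, measureReal_union hd2 hmU (measure_ne_top _ _) (measure_ne_top _ _),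
          measureReal_union hd1 (mB₀.inter mA₁) (measure_ne_top _ _) (measure_ne_top _ _),
          measureReal_biUnion_finset hpd (fun i hi => (mC₀ i hi).inter mA₁) (fun i _ => measure_ne_top _ _),
          Fin.sum_univ_three]
      -- `μ(B⁰) = b₁ + d + Σ cm`
      have hb₀ : μ.real B₀ = b₁ + d + (cm 0 + cm 1 + cm 2) := by
        have hlow : IsLowerSet B := isLowerSet_bottom hup hupA hB
        have hset : B₀ = (B₁ ∪ (B₀ ∩ A₁)) ∪ ⋃ i ∈ (Finset.univ : Finset (Fin 3)), (B₀ ∩ C₁ i) := by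
          ext ω
          simp only [Set.mem_union, Set.mem_inter_iff, Set.mem_iUnion, exists_prop, Finset.mem_univ,
            true_and, hB₁d, hA₁d, hB₀d, hC₁d, Set.mem_preimage]
          constructor
          · intro hω
            rcases htri (insert e ω) with h | h | ⟨i, h⟩
            · exact Or.inl (Or.inr ⟨hω, h⟩)
            · exact Or.inl (Or.inl h)
            · exact Or.inr ⟨i, hω, h⟩
          · rintro ((h | ⟨h, -⟩) | ⟨i, h, -⟩)
            · exact hlow (hle ω) h
            · exact h
            · exact h
        have hpd : (↑(Finset.univ : Finset (Fin 3)) : Set (Fin 3)).PairwiseDisjoint fun i => B₀ ∩ C₁ i :=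
          fun i hi j hj hij => Set.disjoint_left.2 fun ω h1 h2 =>
            Set.disjoint_left.1 (hdisj i (Finset.mem_coe.1 hi) j (Finset.mem_coe.1 hj) hij) h1.2 h2.2
        have hd1 : Disjoint B₁ (B₀ ∩ A₁) :=
          Set.disjoint_left.2 fun ω h1 h2 => Set.disjoint_left.1 hBA h1 h2.2
        have hd2 : Disjoint (B₁ ∪ (B₀ ∩ A₁)) (⋃ i ∈ (Finset.univ : Finset (Fin 3)), (B₀ ∩ C₁ i)) := by
          refine Set.disjoint_left.2 fun ω h1 h2 => ?_
          simp only [Set.mem_iUnion, Set.mem_inter_iff, exists_prop] at h2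
          obtain ⟨i, hi, -, h3⟩ := h2
          rcases h1 with h1 | ⟨-, h1⟩
          · exact Set.disjoint_left.1 (hBC i hi) h1 h3
          · exact Set.disjoint_left.1 (hdisjA i hi) h1 h3
        have hmU : MeasurableSet (⋃ i ∈ (Finset.univ : Finset (Fin 3)), (B₀ ∩ C₁ i)) :=
          Finset.measurableSet_biUnion _ fun i hi => mB₀.inter (mC₁ i hi)
        rw [hset, measureReal_union hd2 hmU (measure_ne_top _ _) (measure_ne_top _ _),
          measureReal_union hd1 (mB₀.inter mA₁) (measure_ne_top _ _) (measure_ne_top _ _),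
          measureReal_biUnion_finset hpd (fun i hi => mB₀.inter (mC₁ i hi)) (fun i _ => measure_ne_top _ _),
          Fin.sum_univ_three]
      -- one-coordinate decompositions of the five masses
      have dA := real_eq_preimage_insert_add_preimage_sdiff p e hA
      have dB := real_eq_preimage_insert_add_preimage_sdiff p e hBdetF
      have dC : ∀ i ∈ (Finset.univ : Finset (Fin 3)),
          μ.real (C i) = p e * (co i + cm i) + (1 - p e) * (co i + cp i) := by
        intro i hi
        rw [hμ, real_eq_preimage_insert_add_preimage_sdiff p e (hC i hi), ← hμ, ← hc₁ i hi, ← hc₀ i hi]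
      have dC0 := dC 0 (Finset.mem_univ _)
      have dC1 := dC 1 (Finset.mem_univ _)
      have dC2 := dC 2 (Finset.mem_univ _)
      -- the induction hypotheses in the refined masses
      have ih₁' : (co 0 + cm 0) * (co 1 + cm 1) + (co 0 + cm 0) * (co 2 + cm 2) + (co 1 + cm 1) * (co 2 + cm 2) +
          (co 0 + cm 0) * (co 1 + cm 1) * (co 2 + cm 2) ≤ (a₀ + d + (cp 0 + cp 1 + cp 2)) * b₁ := by
        have h0 := hc₁ 0 (Finset.mem_univ _)
        have h1 := hc₁ 1 (Finset.mem_univ _)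
        have h2 := hc₁ 2 (Finset.mem_univ _)
        simp only [hC₁d] at h0 h1 h2 ih₁
        rw [h0, h1, h2, ha₁] at ih₁
        exact ih₁
      have ih₀' : (co 0 + cp 0) * (co 1 + cp 1) + (co 0 + cp 0) * (co 2 + cp 2) + (co 1 + cp 1) * (co 2 + cp 2) +
          (co 0 + cp 0) * (co 1 + cp 1) * (co 2 + cp 2) ≤ a₀ * (b₁ + d + (cm 0 + cm 1 + cm 2)) := by
        have h0 := hc₀ 0 (Finset.mem_univ _)
        have h1 := hc₀ 1 (Finset.mem_univ _)
        have h2 := hc₀ 2 (Finset.mem_univ _)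
        simp only [hC₀d] at h0 h1 h2 ih₀
        rw [h0, h1, h2, hb₀] at ih₀
        exact ih₀
      -- the Bernstein-good hypothesis in the refined masses
      have hB1m : 0 ≤ 2 * (a₀ * μ.real B₀ - (μ.real (C₀ 0) * μ.real (C₀ 1) + μ.real (C₀ 0) * μ.real (C₀ 2) + μ.real (C₀ 1) * μ.real (C₀ 2)) - μ.real (C₀ 0) * μ.real (C₀ 1) * μ.real (C₀ 2)) + (μ.real A₁ * b₁ - (μ.real (C₁ 0) * μ.real (C₁ 1) + μ.real (C₁ 0) * μ.real (C₁ 2) + μ.real (C₁ 1) * μ.real (C₁ 2)) - μ.real (C₁ 0) * μ.real (C₁ 1) * μ.real (C₁ 2)) + ((d + (cp 0 + cp 1 + cp 2)) * (d + (cm 0 + cm 1 + cm 2)) + ((1 + μ.real (C₀ 2)) * ((cm 0 - cp 0) * (cm 1 - cp 1)) + (1 + μ.real (C₀ 1)) * ((cm 0 - cp 0) * (cm 2 - cp 2)) + (1 + μ.real (C₀ 0)) * ((cm 1 - cp 1) * (cm 2 - cp 2))) + (cm 0 - cp 0) * (cm 1 - cp 1) * (cm 2 - cp 2)) := by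
        simpa [ha₀, hb₁, hd, hcp, hcm, hA₀d, hA₁d, hB₀d, hB₁d, hC₀d, hC₁d] using hB1e
      have hB2m : 0 ≤ (a₀ * μ.real B₀ - (μ.real (C₀ 0) * μ.real (C₀ 1) + μ.real (C₀ 0) * μ.real (C₀ 2) + μ.real (C₀ 1) * μ.real (C₀ 2)) - μ.real (C₀ 0) * μ.real (C₀ 1) * μ.real (C₀ 2)) + 2 * (μ.real A₁ * b₁ - (μ.real (C₁ 0) * μ.real (C₁ 1) + μ.real (C₁ 0) * μ.real (C₁ 2) + μ.real (C₁ 1) * μ.real (C₁ 2)) - μ.real (C₁ 0) * μ.real (C₁ 1) * μ.real (C₁ 2)) + ((d + (cp 0 + cp 1 + cp 2)) * (d + (cm 0 + cm 1 + cm 2)) + ((1 + μ.real (C₁ 2)) * ((cm 0 - cp 0) * (cm 1 - cp 1)) + (1 + μ.real (C₁ 1)) * ((cm 0 - cp 0) * (cm 2 - cp 2)) + (1 + μ.real (C₁ 0)) * ((cm 1 - cp 1) * (cm 2 - cp 2))) - (cm 0 - cp 0) * (cm 1 - cp 1) * (cm 2 - cp 2)) := by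
        simpa [ha₀, hb₁, hd, hcp, hcm, hA₀d, hA₁d, hB₀d, hB₁d, hC₀d, hC₁d] using hB2e
      have hx0 := hc₀ 0 (Finset.mem_univ _)
      have hx1 := hc₀ 1 (Finset.mem_univ _)
      have hx2 := hc₀ 2 (Finset.mem_univ _)
      have hy0 := hc₁ 0 (Finset.mem_univ _)
      have hy1 := hc₁ 1 (Finset.mem_univ _)
      have hy2 := hc₁ 2 (Finset.mem_univ _)
      simp only [hC₀d, hC₁d] at hx0 hx1 hx2 hy0 hy1 hy2 hB1m hB2m
      rw [ha₁, hb₀, hx0, hx1, hx2, hy0, hy1, hy2] at hB1m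
      rw [ha₁, hb₀, hx0, hx1, hx2, hy0, hy1, hy2] at hB2m
      -- the arithmetic of the Bernstein step
      have hp0 : 0 ≤ (p e : ℝ) := (p e).2.1
      have hp1 : (p e : ℝ) ≤ 1 := (p e).2.2
      have hpb : 0 ≤ 1 - (p e : ℝ) := sub_nonneg.2 hp1
      have hΦ₀ : 0 ≤ (a₀ * (b₁ + d + (cm 0 + cm 1 + cm 2)) - ((co 0 + cp 0) * (co 1 + cp 1) + (co 0 + cp 0) * (co 2 + cp 2) + (co 1 + cp 1) * (co 2 + cp 2)) - (co 0 + cp 0) * (co 1 + cp 1) * (co 2 + cp 2)) := by linarith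
      have hΦ₁ : 0 ≤ ((a₀ + d + (cp 0 + cp 1 + cp 2)) * b₁ - ((co 0 + cm 0) * (co 1 + cm 1) + (co 0 + cm 0) * (co 2 + cm 2) + (co 1 + cm 1) * (co 2 + cm 2)) - (co 0 + cm 0) * (co 1 + cm 1) * (co 2 + cm 2)) := by linarith
      have keyB : ((1 - (p e : ℝ)) * a₀ + (p e : ℝ) * (a₀ + d + (cp 0 + cp 1 + cp 2))) *
            ((1 - (p e : ℝ)) * (b₁ + d + (cm 0 + cm 1 + cm 2)) + (p e : ℝ) * b₁) -
          (((1 - (p e : ℝ)) * (co 0 + cp 0) + (p e : ℝ) * (co 0 + cm 0)) * ((1 - (p e : ℝ)) * (co 1 + cp 1) + (p e : ℝ) * (co 1 + cm 1)) +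
            ((1 - (p e : ℝ)) * (co 0 + cp 0) + (p e : ℝ) * (co 0 + cm 0)) * ((1 - (p e : ℝ)) * (co 2 + cp 2) + (p e : ℝ) * (co 2 + cm 2)) +
            ((1 - (p e : ℝ)) * (co 1 + cp 1) + (p e : ℝ) * (co 1 + cm 1)) * ((1 - (p e : ℝ)) * (co 2 + cp 2) + (p e : ℝ) * (co 2 + cm 2))) -
          ((1 - (p e : ℝ)) * (co 0 + cp 0) + (p e : ℝ) * (co 0 + cm 0)) * ((1 - (p e : ℝ)) * (co 1 + cp 1) + (p e : ℝ) * (co 1 + cm 1)) *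
            ((1 - (p e : ℝ)) * (co 2 + cp 2) + (p e : ℝ) * (co 2 + cm 2)) =
          (1 - (p e : ℝ)) ^ 3 * (a₀ * (b₁ + d + (cm 0 + cm 1 + cm 2)) - ((co 0 + cp 0) * (co 1 + cp 1) + (co 0 + cp 0) * (co 2 + cp 2) + (co 1 + cp 1) * (co 2 + cp 2)) - (co 0 + cp 0) * (co 1 + cp 1) * (co 2 + cp 2)) +
          (1 - (p e : ℝ)) ^ 2 * (p e : ℝ) * (2 * (a₀ * (b₁ + d + (cm 0 + cm 1 + cm 2)) - ((co 0 + cp 0) * (co 1 + cp 1) + (co 0 + cp 0) * (co 2 + cp 2) + (co 1 + cp 1) * (co 2 + cp 2)) - (co 0 + cp 0) * (co 1 + cp 1) * (co 2 + cp 2)) + ((a₀ + d + (cp 0 + cp 1 + cp 2)) * b₁ - ((co 0 + cm 0) * (co 1 + cm 1) + (co 0 + cm 0) * (co 2 + cm 2) + (co 1 + cm 1) * (co 2 + cm 2)) - (co 0 + cm 0) * (co 1 + cm 1) * (co 2 + cm 2)) + ((d + (cp 0 + cp 1 + cp 2)) * (d + (cm 0 + cm 1 + cm 2)) + ((1 +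 (co 2 + cp 2)) * ((cm 0 - cp 0) * (cm 1 - cp 1)) + (1 + (co 1 + cp 1)) * ((cm 0 - cp 0) * (cm 2 - cp 2)) + (1 + (co 0 + cp 0)) * ((cm 1 - cp 1) * (cm 2 - cp 2))) + (cm 0 - cp 0) * (cm 1 - cp 1) * (cm 2 - cp 2))) +
          (1 - (p e : ℝ)) * (p e : ℝ) ^ 2 * ((a₀ * (b₁ + d + (cm 0 + cm 1 + cm 2)) - ((co 0 + cp 0) * (co 1 + cp 1) + (co 0 + cp 0) * (co 2 + cp 2) + (co 1 + cp 1) * (co 2 + cp 2)) - (co 0 + cp 0) * (co 1 + cp 1) * (co 2 + cp 2)) + 2 * ((a₀ + d + (cp 0 + cp 1 + cp 2)) * b₁ - ((co 0 + cm 0) * (co 1 + cm 1) + (co 0 + cm 0) * (co 2 + cm 2) + (co 1 + cm 1) * (co 2 + cm 2)) - (co 0 + cm 0) * (co 1 + cm 1) * (co 2 + cm 2)) + ((d + (cp 0 + cp 1 + cp 2)) * (d + (cm 0 + cm 1 + cm 2)) + ((1 + (co 2 + cm 2)) * ((cm 0 - cp 0) * (cm 1 - cp 1)) + (1 + (co 1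 + cm 1)) * ((cm 0 - cp 0) * (cm 2 - cp 2)) + (1 + (co 0 + cm 0)) * ((cm 1 - cp 1) * (cm 2 - cp 2))) - (cm 0 - cp 0) * (cm 1 - cp 1) * (cm 2 - cp 2))) +
          (p e : ℝ) ^ 3 * ((a₀ + d + (cp 0 + cp 1 + cp 2)) * b₁ - ((co 0 + cm 0) * (co 1 + cm 1) + (co 0 + cm 0) * (co 2 + cm 2) + (co 1 + cm 1) * (co 2 + cm 2)) - (co 0 + cm 0) * (co 1 + cm 1) * (co 2 + cm 2)) := by
        ring
      have t0 : 0 ≤ (1 - (p e : ℝ)) ^ 3 * (a₀ * (b₁ + d + (cm 0 + cm 1 + cm 2)) - ((co 0 + cp 0) * (co 1 + cp 1) + (co 0 + cp 0) * (co 2 + cp 2) + (co 1 + cp 1) * (co 2 + cp 2)) - (co 0 + cp 0) * (co 1 + cp 1) * (co 2 + cp 2)) := mul_nonneg (pow_nonneg hpb 3) hΦ₀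
      have t1 : 0 ≤ (p e : ℝ) ^ 3 * ((a₀ + d + (cp 0 + cp 1 + cp 2)) * b₁ - ((co 0 + cm 0) * (co 1 + cm 1) + (co 0 + cm 0) * (co 2 + cm 2) + (co 1 + cm 1) * (co 2 + cm 2)) - (co 0 + cm 0) * (co 1 + cm 1) * (co 2 + cm 2)) := mul_nonneg (pow_nonneg hp0 3) hΦ₁
      have t2 : 0 ≤ (1 - (p e : ℝ)) ^ 2 * (p e : ℝ) * (2 * (a₀ * (b₁ + d + (cm 0 + cm 1 + cm 2)) - ((co 0 + cp 0) * (co 1 + cp 1) + (co 0 + cp 0) * (co 2 + cp 2) + (co 1 + cp 1) * (co 2 + cp 2)) - (co 0 + cp 0) * (co 1 + cp 1) * (co 2 + cp 2)) + ((a₀ + d + (cp 0 + cp 1 + cp 2)) * b₁ - ((co 0 + cm 0) * (co 1 + cm 1) + (co 0 + cm 0) * (co 2 + cm 2) + (co 1 + cm 1) * (co 2 + cm 2)) - (co 0 + cm 0) * (co 1 + cm 1) * (co 2 + cm 2)) + ((d + (cp 0 + cp 1 + cp 2)) * (d + (cm 0 + cm 1 + cm 2)) + ((1 + (co 2 + cp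 2)) * ((cm 0 - cp 0) * (cm 1 - cp 1)) + (1 + (co 1 + cp 1)) * ((cm 0 - cp 0) * (cm 2 - cp 2)) + (1 + (co 0 + cp 0)) * ((cm 1 - cp 1) * (cm 2 - cp 2))) + (cm 0 - cp 0) * (cm 1 - cp 1) * (cm 2 - cp 2))) :=
        mul_nonneg (mul_nonneg (pow_nonneg hpb 2) hp0) hB1m
      have t3 : 0 ≤ (1 - (p e : ℝ)) * (p e : ℝ) ^ 2 * ((a₀ * (b₁ + d + (cm 0 + cm 1 + cm 2)) - ((co 0 + cp 0) * (co 1 + cp 1) + (co 0 + cp 0) * (co 2 + cp 2) + (co 1 + cp 1) * (co 2 + cp 2)) - (co 0 + cp 0) * (co 1 + cp 1) * (co 2 + cp 2)) + 2 * ((a₀ + d + (cp 0 + cp 1 + cp 2)) * b₁ - ((co 0 + cm 0) * (co 1 + cm 1) + (co 0 + cm 0) * (co 2 + cm 2) + (co 1 + cm 1) * (co 2 + cm 2)) - (co 0 + cm 0) * (co 1 + cm 1) * (co 2 + cm 2)) + ((d + (cp 0 + cp 1 + cp 2)) * (d + (cm 0 + cm 1 + cm 2)) + ((1 + (co 2 +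 cm 2)) * ((cm 0 - cp 0) * (cm 1 - cp 1)) + (1 + (co 1 + cm 1)) * ((cm 0 - cp 0) * (cm 2 - cp 2)) + (1 + (co 0 + cm 0)) * ((cm 1 - cp 1) * (cm 2 - cp 2))) - (cm 0 - cp 0) * (cm 1 - cp 1) * (cm 2 - cp 2))) :=
        mul_nonneg (mul_nonneg hpb (pow_nonneg hp0 2)) hB2m
      rw [dA, dB, dC0, dC1, dC2, ha₁, hb₀]
      linarith [keyB, t0, t1, t2, t3]

end SunflowerCubic

end Summit.CriticalPhenomena.PercolationContinuityZ3.Theorems
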